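import Literature.NumberTheory.DiophantineGeometry.ConductorAdditiveProofs
import Literature.NumberTheory.DiophantineGeometry.ConductorFactorizationProofs
import Literature.NumberTheory.DiophantineGeometry.ConductorRingOfIntegersProofs
import Literature.NumberTheory.Automorphic.CDTTheorem722
import Literature.NumberTheory.Automorphic.CDTTheorem712
import Literature.NumberTheory.EllipticCurves.BSDConductorProofs
import Literature.NumberTheory.EllipticCurves.FramedTateGaloisRep
import Literature.NumberTheory.GaloisRepresentations.OrdinaryGaloisRep
import Literature.NumberTheory.GaloisRepresentations.LocalKroneckerWeberInertiaProofs
import HarnessLib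

/-!
# STUB-IDEAS `stub_liftFive` — ideator k = 3 (FAMILY 3, PROBE THE EXTREMES), GEN 11 companion

Crux `Summit.ABC.ABC.Theses.DefiniteXi.FreyModularity` (stmt-ABC-11340), skeleton `Lines/Sketch.lean`
(sha 21576c53), stub `stub_liftFive` (verbatim text = `SigLiftFive` below, used only as a hypothesis
carrier — the registered stub is never retyped).  Literature-only imports; no instances, no notation.
`lean check`: rc 0, 0 sorries.

* **W1** `liftFiveLocalCorner_of_sigLiftFive` (PROVED): the verbatim stub implies the k3 curve-level
  corner fact E6c `LiftFiveLocalCorner` (gen-6 decl verbatim).  With gen 6's proved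
  `liftFiveLocalCorner_of_wiles` (E6 + P2′ + P4 ⇒ E6c; P2′ = gen-10 corner theorem, P4 = gen 7) this
  certifies the lattice `CDT_theorem_7_2_2 ⇒ stub ⇒ E6c ⇐ E6`, i.e. E6c is the WEAKEST `R = T`
  commitment among all closers of the slot; `E6c + S4b ⇒ case B` is gen 5/6 (proved).
* **W1′** `liftFiveLocalCorner_of_CDT_theorem_7_2_2` (PROVED): the catalogued fact implies E6c.
* **N0** `not_isOrdinaryOfWeightAt_two_one_of_trivial_on_inertia` (PROVED): non-vacuity of
  `FramedGaloisRep.IsOrdinaryOfWeightAt p · v 2 1` over `ℚ` — a framed representation trivial on the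
  inertia group at `v ∣ p` is not ordinary of weight `2`, exponent `1` (`χ_p(I_{ℚ_v}) = ℤ_pˣ`, tree
  `adicCompletion_rat_exists_mem_absInertia_cyclotomicCharacter_eq`; `1 ≠ -1` in characteristic `0`).
* `sq_dvd_conductorNorm_iff_hasAdditiveReductionAt'` is a verbatim copy of the LANDED
  `Summit.ABC.ABC.Theorems.sq_dvd_conductorNorm_iff_hasAdditiveReductionAt` (p110220), inlined only to
  keep this file's imports inside `Literature/`; a landing Theorems file cites the landed one instead.
-/

open scoped MatrixGroups NumberField
open Literature.NumberTheory.EllipticCurves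
open Literature.NumberTheory.EllipticCurves.ModularForms
open Literature.NumberTheory.DiophantineGeometry
open Literature.NumberTheory.Automorphic
open Literature.NumberTheory.Automorphic.BCDT
open Literature.NumberTheory.GaloisRepresentations
open WeierstrassCurve IsDedekindDomain Rat.HeightOneSpectrum Field

namespace Summit.ABC.ABC.Cruxes.FreyModularity.StubIdeas.LiftFive3g11

/-- The registered stub signature, VERBATIM (never retyped; here only as a hypothesis carrier). -/
def SigLiftFive : Prop :=
  ∀ (W : WeierstrassCurve ℚ) [W.IsElliptic] (ρ : ModPGaloisRep ℚ (ZMod 5) 2),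
    W.IsTorsionGaloisRep 5 ρ → ρ.IsAbsIrreducibleOverSqrt 5 → ¬ 25 ∣ W.conductorNorm ℤ →
    ρ.IsModular → W.IsModularGaloisRepTate 5

/-- **E6c `LiftFiveLocalCorner`** — gen-6 decl VERBATIM (curve-level Wiles (i) corner at `5`). -/
def LiftFiveLocalCorner : Prop :=
  ∀ (W W' : WeierstrassCurve ℚ) [W.IsElliptic] [W'.IsElliptic] [NeZero (W'.conductorNorm ℤ)]
    (ρ : ModPGaloisRep ℚ (ZMod 5) 2),
    W.IsTorsionGaloisRep 5 ρ → W'.IsTorsionGaloisRep 5 ρ → ρ.IsAbsIrreducibleOverSqrt 5 →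
    BCDT.IsModular W' →
    (∀ v : HeightOneSpectrum (𝓞 ℚ), ((5 : ℕ) : 𝓞 ℚ) ∈ v.asIdeal →
      W.HasMultiplicativeReductionAt v) →
    (∀ v : HeightOneSpectrum (𝓞 ℚ), ((5 : ℕ) : 𝓞 ℚ) ∉ v.asIdeal →
      W.HasGoodReductionAt v ∨ W.HasMultiplicativeReductionAt v) →
    W.IsModularGaloisRepTate 5

/-- `p² ∣ N_E ↔` additive reduction at the place of `𝓞 ℚ` over `p` — VERBATIM the landed
`Summit.ABC.ABC.Theorems.sq_dvd_conductorNorm_iff_hasAdditiveReductionAt` (p110220), inlined here only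
so that this sketch has Literature-only imports. -/
theorem sq_dvd_conductorNorm_iff_hasAdditiveReductionAt' (W : WeierstrassCurve ℚ) [W.IsElliptic]
    {p : ℕ} (hp : p.Prime) {v : HeightOneSpectrum (𝓞 ℚ)}
    (hv : (Rat.HeightOneSpectrum.primesEquiv v : ℕ) = p) :
    p ^ 2 ∣ W.conductorNorm ℤ ↔ W.HasAdditiveReductionAt v := by
  classical
  set pp : Nat.Primes := ⟨p, hp⟩ with hpp
  have hvp : Rat.HeightOneSpectrum.primesEquiv v = pp := Subtype.ext hv
  set vZ : HeightOneSpectrum ℤ := (Rat.HeightOneSpectrum.primesEquiv (R := ℤ)).symm pp with hvZ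
  have hfac := factorization_conductorNorm_holds W vZ
  have hgen : Rat.HeightOneSpectrum.natGenerator vZ = p := by
    change ((Rat.HeightOneSpectrum.primesEquiv vZ : Nat.Primes) : ℕ) = p
    rw [hvZ, Equiv.apply_symm_apply]
  rw [hgen] at hfac
  have hf : W.conductorExponent v = W.conductorExponent vZ := by
    rw [conductorExponent_ringOfIntegers_eq W v, hvp]
  rw [Nat.Prime.pow_dvd_iff_le_factorization hp (conductorNorm_pos_holds W).ne', hfac, ← hf,
    two_le_conductorExponent_iff_holds v W]

/-- **W1 (XS, the extremal certificate): the verbatim stub implies E6c.**  `ρ̄` modular from `W'`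
modular (`IsModular.isModular_of_isTorsionGaloisRep''`), `25 ∤ N_W` from multiplicative reduction at
the place over `5` (`sq_dvd_conductorNorm_iff_hasAdditiveReductionAt`, landed p110220, +
`HasMultiplicativeReductionAt.not_hasAdditiveReductionAt`); the off-`5` hypothesis is not even used. -/
theorem liftFiveLocalCorner_of_sigLiftFive (h : SigLiftFive) : LiftFiveLocalCorner := by
  intro W W' _ _ _ ρ hρ hρ' hirr hmod hmult _hoff
  have h5 : Nat.Prime 5 := by norm_num
  have hvp : ((Rat.HeightOneSpectrum.primesEquiv
      ((Rat.HeightOneSpectrum.primesEquiv (R := 𝓞 ℚ)).symm ⟨5, h5⟩) : Nat.Primes) : ℕ) = 5 := by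
    rw [Equiv.apply_symm_apply]
  have hmem : ((5 : ℕ) : 𝓞 ℚ) ∈
      ((Rat.HeightOneSpectrum.primesEquiv (R := 𝓞 ℚ)).symm ⟨5, h5⟩).asIdeal :=
    (natCast_mem_asIdeal_iff_eq_primesEquiv_symm _ h5).mpr rfl
  have h25 : ¬ 25 ∣ W.conductorNorm ℤ := fun h25 =>
    (hmult _ hmem).not_hasAdditiveReductionAt
      ((sq_dvd_conductorNorm_iff_hasAdditiveReductionAt' W h5 hvp).mp
        (by simpa using h25))
  exact h W ρ hρ hirr h25 (hmod.isModular_of_isTorsionGaloisRep'' hρ')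

/-- **W1′: hence the catalogued `CDT_theorem_7_2_2` implies E6c** (skeleton's
`stub_liftFive_of_CDT_theorem_7_2_2` composed with W1). -/
theorem liftFiveLocalCorner_of_CDT_theorem_7_2_2 (h : CDT_theorem_7_2_2) : LiftFiveLocalCorner :=
  liftFiveLocalCorner_of_sigLiftFive fun W _ ρ hρ hirr _ hmod ↦
    lift_of_CDT_theorem_7_2_2 h W ρ hρ hirr hmod

/-- **N0 (XS–S, non-vacuity of the ordinary predicate at exponent 1 over `ℚ`).**  A framed
representation whose restriction to the inertia group at the place `v ∣ p` is trivial is NOT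
ordinary of weight `2` with inertial exponent `1` at `v`: some `σ ∈ I_{ℚ_v}` has `χ_p(σ) = 1 + p ≠ 1`
(`adicCompletion_rat_exists_mem_absInertia_cyclotomicCharacter_eq`), while the `(0,0)` entry of
`Q⁻¹ ρ(σ) Q = 1` is `1`, and `algebraMap ℤ_[p] ℚ̄_p` is injective. -/
theorem not_isOrdinaryOfWeightAt_two_one_of_trivial_on_inertia (p : ℕ) [Fact p.Prime]
    (ρ : FramedGaloisRep ℚ (PadicAlgCl p) 2) (v : HeightOneSpectrum (𝓞 ℚ))
    (hv : (Rat.HeightOneSpectrum.primesEquiv v : ℕ) = p)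
    (htriv : ∀ σ ∈ absInertia (v.adicCompletion ℚ), ρ.toLocal v σ = 1) :
    ¬ FramedGaloisRep.IsOrdinaryOfWeightAt p ρ v 2 1 := by
  rintro ⟨Q, hQ⟩
  obtain ⟨σ, hσI, hχ⟩ :=
    adicCompletion_rat_exists_mem_absInertia_cyclotomicCharacter_eq p v hv (-1)
  obtain ⟨-, h00⟩ := (hQ σ).2 hσI
  rw [htriv σ hσI, mul_one, inv_mul_cancel, hχ] at h00
  simp only [Units.val_one, Matrix.one_apply_eq, pow_one, Units.val_neg, map_neg, map_one,
    Nat.add_one_sub_one, one_mul] at h00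
  have h2 : (2 : PadicAlgCl p) = 0 := by linear_combination h00
  exact absurd h2 two_ne_zero

end Summit.ABC.ABC.Cruxes.FreyModularity.StubIdeas.LiftFive3g11
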